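import Summits.QuantumFields.BalabanUV.T4Continuum.Support.ShellMeasureWilsonLedgerWindow
import Summits.QuantumFields.BalabanUV.T4Continuum.Support.ShellMeasureRootCompositionSync

/-!
# `T4Continuum.ShellMeasureWilsonLedgerSync` — the level-0 faces in the SLOT-INDEXED (age-synchronised) threshold
# typing: per-CUTOFF level-0 thresholds `θ₀ K` for rows S17∕S19 and their realized `SU(2)` family, under END-I's window
# — kernel bookkeeping, no estimate (cell `pub-balaban`, sub-cell `t4`, spine estimate NE7c (node U5b); NE7c ROUND-2
# crew seat `b2b-balaban-t4-ne7c-formalise-leaf-09` (gen 4), file 2 of the OFFER «the level-0 faces under END-I's live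
# window» to the claim table `t4/b2b-balaban-t4-ne7c-p1/LEAVES-NE7c-P1.md` (the owner t4-ne7c-p1 books ∕ renumbers ∕
# refuses); ADDITIVE — imports file 1 `ShellMeasureWilsonLedgerWindow` (p212612) and the sync END-I
# `ShellMeasureRootCompositionSync` (p211299) only and modifies nothing; 0 `def`, 0 sorry, 0 citations)

HONEST FRAMING.  Finite four-torus programme, rung (B)+1 only — NOT infinite volume, NOT a mass gap, NOT the Clay
problem, NOT summit progress; (B), `BetaPertHyp`, (B^μ) are not consumed.  NE7c = `T4IndicatorShell.ShellWeightBound`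
is NOT PRINTED in [Balaban 1983–89] and NOT PROVED; every result below reads «NE7c ⇐ the named binders» (trigger c3);
a level-0 face is NOT NE7c ((M1)₀ realized ≠ NE7c).  HONEST DEPENDENCY (cell): continuum YM on T⁴ ⇐ BetaPertH ∧ nine
spine estimates (0/9 proved); BetaPertH ⇐ (D1) ∧ (D4) ∧ CAP+tail; G-an2-4 gates asym, D1 and NE2/3/4.

THE POINT (typer's T-NE7c-7 = referee DV-14 = this lineage's FINDING F-ne7cleaf09-3, carried to the level-0 faces).
Rows S12∕S17∕S19 type the level-0 threshold as ONE number `θ 0` for EVERY cutoff `K` (END-I's level-indexed `θ (lvl K s)`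
at `lvl ≡ 0`).  Under the cell's design D8 (`T4SyncThresholds`) the threshold of a slot is a function of its AGE
`K − lvl`; a level-0 slot of comparison `K` has age `K`, so its threshold is `ε(ḡ_K)` — it VARIES with the cutoff
(in print the first small-field threshold is a function of the bare coupling, which runs with the cutoff).  With one
`θ 0` the level-0 faces therefore host D8 only when the window holds a single cutoff; the sync END-I
(`ShellMeasureRootCompositionSync.levelLedger_of_slotAC_sync`, thresholds `θ K s`) hosts them in general.  This file is
that bookkeeping for the cube-partition faces: every binder of row S17's plug and of row S19's realized family is re-read
at a PER-CUTOFF level-0 threshold `θ₀ K` (`θ K s := θ₀ K`), the window of file 1 (END-I's `LiveWindow.recent` at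
`lvl ≡ 0`: `∀ K, ∀ s ∈ C K, K ≤ N₁`) rides along, and the level constant is file 1's finite WINDOW SUM.  Nothing landed
is lost: `θ₀ := fun _ => θ 0` is rows S17∕S19 (§3 `example`).
* §1 `levelLedger_levelZero_cubes_sync` — row S17's `levelLedger_levelZero_cubes` with terms, shell parts, pieces, the
  a.e. closeness `|u^A − u^B| ≤ ρ₀·θ₀ K` and the wall (M1)₀ all at the cutoff's own threshold `θ₀ K`; conclusion
  LITERALLY `T4ShellMeasureLevels.LevelLedger …` (by `levelLedger_of_slotAC_sync`); `…_sync_window` (slot constants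
  `D_{K,s}` under the window, level constant the window sum), `omega_levelZero_cubes_sync_window(_eq_zero)` (the face
  books `#(C K)·W·ρ₀` at `K ≤ N₁`, nothing beyond), `shellWeightBound_levelZero_sync_window` (two such faces close R0
  through file 1's window-truncated END — DEGENERATE, no live level `j ≥ 1`, NOT NE7c).
* §2 `levelLedger_wilson_su2_levelZero_family_sync_window` — row S19 file 3 ∕ file 1 §3 with the level-0 numerics of
  cutoff `K` read at `θ₀ K`: `0 < θ₀ K ≤ σc K`, `4(8S_K)²e^{16S_K} ≤ δ·θ₀ K`, closeness `≤ ρ₀·θ₀ K`; (M1)₀ per `(K, s)`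
  by row S19 file 2's `slotAntiConcentration_wilson_su2_gibbs_source` BY NAME at `θ := θ₀ K`; NO `hD`.
Nothing printed is asserted; [folklore] composition BY NAME.

WHAT THIS DOES NOT DO.  No live level `j ≥ 1`, no END-II binder touched (SM-L1…L8 displayed as before); the level-0
closeness (node U1b TYPE, now at `θ₀ K`), the slot count and the per-`K` numerics stay displayed; which profile `ε`
and which coupling sequence `ḡ` the cell synchronises on is D8's (`T4SyncThresholds`), not decided here; NE7c NOT proved;
0/9 spine.
-/

noncomputable section

open Set Function MeasureTheory Finset

namespace Summit.QuantumFields.BalabanUV.T4Continuum.ShellMeasureWilsonLedgerSync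

open scoped ENNReal
open Literature.MathematicalPhysics.QuantumFieldTheory.Balaban1983to89
open T4IndicatorShell (ShellWeightBound)
open T4ShellMeasure (SlotAntiConcentration SlotLedger)
open T4ShellMeasureLevels (LevelLedger LiveWindow)
open T4CubeChartGnomonic (SU2)
open T4AxialGaugeFixing (combBonds)
open T4AxialGaugeSmallField (boxPlaqs boxBonds)
open ShellMeasureWilsonRealizedSU2 (wilsonU measurable_wilsonU wilsonSum_nonneg)
open ShellMeasureRootCompositionPushCubes (regionWeight regionShell regionPiece regionShell_nonneg
  regionShell_le_regionWeight regionShell_le_sum_piece sum_regionPiece_le sum_regionWeight_eq levelLedger_levelZero_cubes)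
open ShellMeasureRootCompositionSync (levelLedger_of_slotAC_sync)
open ShellMeasureWilsonLedgerSource (slotAntiConcentration_wilson_su2_gibbs_source)
open ShellMeasureWilsonLedgerWindow (eq_empty_of_window windowSum_nonneg slotConst_le_windowSum
  shellWeightBound_of_slotLedger_window)

/-! ## §1 Level 0 with per-cutoff thresholds: the ledger, the window, the weight, the degenerate END -/

section LevelZero

variable {Ω : ℕ → Type*} [∀ K, MeasurableSpace (Ω K)] {σ : Type*} [DecidableEq σ] {C : ℕ → Finset σ} {N₁ : ℕ}
  {l₀ : ℝ}

/-- **LEVEL 0, FULL CUBE PARTITION, PER-CUTOFF THRESHOLDS: `LevelLedger` ⇐ (M1)₀ PER SLOT.**  Row S17's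
`levelLedger_levelZero_cubes` with the level-0 threshold of comparison `K` ITS OWN number `θ₀ K` (the age-`K` threshold
of D8) in the terms `regionWeight … (θ₀ K)`, the shell parts, the pieces, the a.e. closeness `|u^A_s − u^B_s| ≤ ρ₀·θ₀ K`
and the wall `hac`; `M = 1`; widths `ρ` and constants `D` by level (only level `0` is read).  The six (R)+[dict] binders
are row S17's object lemmas at the real threshold `θ₀ K`; the ledger is the SYNC END-I's one-run plug
`ShellMeasureRootCompositionSync.levelLedger_of_slotAC_sync` at `θ K s := θ₀ K`.  CONDITIONAL on `hac` and the
closeness; nothing printed asserted. [folklore] -/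
theorem levelLedger_levelZero_cubes_sync {μ : ∀ K : ℕ, ℝ → Measure (Ω K)} [∀ K t, IsFiniteMeasure (μ K t)]
    {uA uB : ∀ K : ℕ, ℝ → σ → Ω K → ℝ} {θ₀ ρ D : ℕ → ℝ}
    (huA : ∀ K t s, Measurable (uA K t s)) (huB : ∀ K t s, Measurable (uB K t s))
    (hclose : ∀ K t, |t| ≤ l₀ → ∀ s ∈ C K, ∀ᵐ ω ∂(μ K t), |uA K t s ω - uB K t s ω| ≤ ρ 0 * θ₀ K)
    (hD : ∀ j, 0 ≤ D j) (hρ : ∀ j, 0 ≤ ρ j)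
    (hac : ∀ K t, |t| ≤ l₀ → ∀ s ∈ C K, SlotAntiConcentration (μ K t) (uA K t s) (θ₀ K) (ρ 0) (D 0)) :
    LevelLedger l₀ (fun K => (C K).powerset) (fun K t => regionWeight (C K) (μ K t) (uA K t) (θ₀ K))
      (fun K t => regionShell (C K) (μ K t) (uA K t) (uB K t) (θ₀ K)) C
      (fun K t => regionPiece (C K) (μ K t) (uA K t) (uB K t) (θ₀ K)) (fun _ _ => 0) D ρ :=
  levelLedger_of_slotAC_sync (Ω := fun K _ => Ω K) (μ := fun K t _ => μ K t) (u := fun K t s => uA K t s)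
    (θ := fun K _ => θ₀ K) (M := fun _ _ _ => (1 : ℝ))
    (fun K t _ O _ => regionShell_nonneg (C K) (μ K t) (uA K t) (uB K t) (θ₀ K) O)
    (fun K t _ O _ => regionShell_le_regionWeight (C K) (μ K t) (huA K t) (uB K t) (θ₀ K) O)
    (fun K t _ _ hO => regionShell_le_sum_piece (C K) (μ K t) (huA K t) (huB K t) (θ₀ K) (Finset.mem_powerset.1 hO))
    (fun _ _ _ _ _ => zero_le_one)
    (fun K t ht s hs => sum_regionPiece_le (C K) (μ K t) (huA K t) (huB K t) hs (hclose K t ht s hs))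
    (fun K t _ _ _ => by rw [one_mul, sum_regionWeight_eq (C K) (μ K t) (huA K t) (θ₀ K)])
    hD hρ hac

/-- **… UNDER THE WINDOW, WITH SLOT CONSTANTS.**  The same with the wall carrying SLOT constants `D_{K,s} ≥ 0` and
file 1's level-0 window `∀ K, ∀ s ∈ C K, K ≤ N₁` (END-I's `LiveWindow.recent` at `lvl ≡ 0`); the level constant is
file 1's WINDOW SUM `Σ_{K ≤ N₁} Σ_{s ∈ C K} D_{K,s}` — NO cutoff-uniformity binder. [folklore] -/
theorem levelLedger_levelZero_cubes_sync_window {μ : ∀ K : ℕ, ℝ → Measure (Ω K)} [∀ K t, IsFiniteMeasure (μ K t)]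
    {uA uB : ∀ K : ℕ, ℝ → σ → Ω K → ℝ} {θ₀ ρ : ℕ → ℝ} {Dslot : ℕ → σ → ℝ}
    (huA : ∀ K t s, Measurable (uA K t s)) (huB : ∀ K t s, Measurable (uB K t s))
    (hclose : ∀ K t, |t| ≤ l₀ → ∀ s ∈ C K, ∀ᵐ ω ∂(μ K t), |uA K t s ω - uB K t s ω| ≤ ρ 0 * θ₀ K)
    (hρ : ∀ j, 0 ≤ ρ j) (hDs : ∀ K, ∀ s ∈ C K, 0 ≤ Dslot K s) (hwin : ∀ K, ∀ s ∈ C K, K ≤ N₁)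
    (hac : ∀ K t, |t| ≤ l₀ → ∀ s ∈ C K, SlotAntiConcentration (μ K t) (uA K t s) (θ₀ K) (ρ 0) (Dslot K s)) :
    LevelLedger l₀ (fun K => (C K).powerset) (fun K t => regionWeight (C K) (μ K t) (uA K t) (θ₀ K))
      (fun K t => regionShell (C K) (μ K t) (uA K t) (uB K t) (θ₀ K)) C
      (fun K t => regionPiece (C K) (μ K t) (uA K t) (uB K t) (θ₀ K)) (fun _ _ => 0)
      (fun _ => ∑ K' ∈ Finset.range (N₁ + 1), ∑ s' ∈ C K', Dslot K' s') ρ :=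
  levelLedger_levelZero_cubes_sync huA huB hclose (fun _ => windowSum_nonneg hDs) hρ fun K t ht s hs =>
    T4ShellMeasureFibre.slotAntiConcentration_mono (hρ 0) (slotConst_le_windowSum hDs (hwin K s hs) hs)
      (hac K t ht s hs)

/-- the relative shell weight booked at cutoff `K`: `ω K = #(C K) · (W · ρ₀)`, `W` the window sum. [folklore] -/
theorem omega_levelZero_cubes_sync_window {μ : ∀ K : ℕ, ℝ → Measure (Ω K)} [∀ K t, IsFiniteMeasure (μ K t)]
    {uA uB : ∀ K : ℕ, ℝ → σ → Ω K → ℝ} {θ₀ ρ : ℕ → ℝ} {Dslot : ℕ → σ → ℝ}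
    (huA : ∀ K t s, Measurable (uA K t s)) (huB : ∀ K t s, Measurable (uB K t s))
    (hclose : ∀ K t, |t| ≤ l₀ → ∀ s ∈ C K, ∀ᵐ ω ∂(μ K t), |uA K t s ω - uB K t s ω| ≤ ρ 0 * θ₀ K)
    (hρ : ∀ j, 0 ≤ ρ j) (hDs : ∀ K, ∀ s ∈ C K, 0 ≤ Dslot K s) (hwin : ∀ K, ∀ s ∈ C K, K ≤ N₁)
    (hac : ∀ K t, |t| ≤ l₀ → ∀ s ∈ C K, SlotAntiConcentration (μ K t) (uA K t s) (θ₀ K) (ρ 0) (Dslot K s))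
    (K : ℕ) :
    (levelLedger_levelZero_cubes_sync_window huA huB hclose hρ hDs hwin hac).toSlotLedger.omega K =
      (C K).card * ((∑ K' ∈ Finset.range (N₁ + 1), ∑ s' ∈ C K', Dslot K' s') * ρ 0) :=
  (T4ShellMeasureLevels.LevelLedger.omega_eq (levelLedger_levelZero_cubes_sync_window huA huB hclose hρ hDs hwin hac)
    K).trans (by rw [Finset.sum_const, nsmul_eq_mul])

/-- **NO SHELL WEIGHT BEYOND THE WINDOW**: `ω K = 0` for `K > N₁` (no level-0 slot there, file 1's
`eq_empty_of_window`). [folklore] -/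
theorem omega_levelZero_cubes_sync_window_eq_zero {μ : ∀ K : ℕ, ℝ → Measure (Ω K)} [∀ K t, IsFiniteMeasure (μ K t)]
    {uA uB : ∀ K : ℕ, ℝ → σ → Ω K → ℝ} {θ₀ ρ : ℕ → ℝ} {Dslot : ℕ → σ → ℝ}
    (huA : ∀ K t s, Measurable (uA K t s)) (huB : ∀ K t s, Measurable (uB K t s))
    (hclose : ∀ K t, |t| ≤ l₀ → ∀ s ∈ C K, ∀ᵐ ω ∂(μ K t), |uA K t s ω - uB K t s ω| ≤ ρ 0 * θ₀ K)
    (hρ : ∀ j, 0 ≤ ρ j) (hDs : ∀ K, ∀ s ∈ C K, 0 ≤ Dslot K s) (hwin : ∀ K, ∀ s ∈ C K, K ≤ N₁)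
    (hac : ∀ K t, |t| ≤ l₀ → ∀ s ∈ C K, SlotAntiConcentration (μ K t) (uA K t s) (θ₀ K) (ρ 0) (Dslot K s))
    {K : ℕ} (hK : N₁ < K) :
    (levelLedger_levelZero_cubes_sync_window huA huB hclose hρ hDs hwin hac).toSlotLedger.omega K = 0 := by
  rw [omega_levelZero_cubes_sync_window huA huB hclose hρ hDs hwin hac K, eq_empty_of_window hwin hK,
    Finset.card_empty, Nat.cast_zero, zero_mul]

/-- **TWO LEVEL-0 CUBE FACES WITH PER-CUTOFF THRESHOLDS UNDER THE WINDOW CLOSE R0 — DEGENERATELY.**  Run A (measures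
`μ^A K t`, variables `u^A`, threshold `θ^A₀ K`, closeness to `u^B` under `μ^A`, (M1)₀ per live slot with slot
constants) and run B (roles exchanged, own measures `μ^B K t`, own thresholds `θ^B₀ K`) on the COMMON cube family `C`
under the level-0 window: `T4IndicatorShell.ShellWeightBound` LITERALLY, through file 1's window-truncated END
`shellWeightBound_of_slotLedger_window`, with the explicit finitely supported `Wsh K = #(C K)·(W^A ρ^A₀ + W^B ρ^B₀)`.
NOT NE7c: no live level `j ≥ 1` (T-NE7c-3); (M1)₀ and the closeness are hypotheses. [folklore] -/
theorem shellWeightBound_levelZero_sync_window {μA μB : ∀ K : ℕ, ℝ → Measure (Ω K)}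
    [∀ K t, IsFiniteMeasure (μA K t)] [∀ K t, IsFiniteMeasure (μB K t)] {uA uB : ∀ K : ℕ, ℝ → σ → Ω K → ℝ}
    {θA ρA θB ρB : ℕ → ℝ} {DslotA DslotB : ℕ → σ → ℝ}
    (huA : ∀ K t s, Measurable (uA K t s)) (huB : ∀ K t s, Measurable (uB K t s))
    (hcloseA : ∀ K t, |t| ≤ l₀ → ∀ s ∈ C K, ∀ᵐ ω ∂(μA K t), |uA K t s ω - uB K t s ω| ≤ ρA 0 * θA K)
    (hcloseB : ∀ K t, |t| ≤ l₀ → ∀ s ∈ C K, ∀ᵐ ω ∂(μB K t), |uB K t s ω - uA K t s ω| ≤ ρB 0 * θB K)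
    (hρA : ∀ j, 0 ≤ ρA j) (hρB : ∀ j, 0 ≤ ρB j) (hDsA : ∀ K, ∀ s ∈ C K, 0 ≤ DslotA K s)
    (hDsB : ∀ K, ∀ s ∈ C K, 0 ≤ DslotB K s) (hwin : ∀ K, ∀ s ∈ C K, K ≤ N₁)
    (hacA : ∀ K t, |t| ≤ l₀ → ∀ s ∈ C K, SlotAntiConcentration (μA K t) (uA K t s) (θA K) (ρA 0) (DslotA K s))
    (hacB : ∀ K t, |t| ≤ l₀ → ∀ s ∈ C K, SlotAntiConcentration (μB K t) (uB K t s) (θB K) (ρB 0) (DslotB K s)) :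
    ShellWeightBound l₀ (fun K => (C K).powerset)
      (fun K t => regionWeight (C K) (μA K t) (uA K t) (θA K)) (fun K t => regionWeight (C K) (μB K t) (uB K t) (θB K))
      (fun K t => regionShell (C K) (μA K t) (uA K t) (uB K t) (θA K))
      (fun K t => regionShell (C K) (μB K t) (uB K t) (uA K t) (θB K))
      (fun K => (C K).card * ((∑ K' ∈ Finset.range (N₁ + 1), ∑ s' ∈ C K', DslotA K' s') * ρA 0) +
        (C K).card * ((∑ K' ∈ Finset.range (N₁ + 1), ∑ s' ∈ C K', DslotB K' s') * ρB 0)) := by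
  have hA := levelLedger_levelZero_cubes_sync_window huA huB hcloseA hρA hDsA hwin hacA
  have hB := levelLedger_levelZero_cubes_sync_window huB huA hcloseB hρB hDsB hwin hacB
  have h := shellWeightBound_of_slotLedger_window hA.toSlotLedger hB.toSlotLedger
    (fun K hK => omega_levelZero_cubes_sync_window_eq_zero huA huB hcloseA hρA hDsA hwin hacA hK)
    (fun K hK => omega_levelZero_cubes_sync_window_eq_zero huB huA hcloseB hρB hDsB hwin hacB hK)
  have hW : (fun K => hA.toSlotLedger.omega K + hB.toSlotLedger.omega K) =
      (fun K => (C K).card * ((∑ K' ∈ Finset.range (N₁ + 1), ∑ s' ∈ C K', DslotA K' s') * ρA 0) +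
        (C K).card * ((∑ K' ∈ Finset.range (N₁ + 1), ∑ s' ∈ C K', DslotB K' s') * ρB 0)) := by
    funext K
    rw [omega_levelZero_cubes_sync_window huA huB hcloseA hρA hDsA hwin hacA K,
      omega_levelZero_cubes_sync_window huB huA hcloseB hρB hDsB hwin hacB K]
  exact hW ▸ h

end LevelZero

/-! ## §2 The realized `SU(2)` level-0 family ledger with per-cutoff thresholds, under the window -/

section Realized

variable (P : ℕ → Params) (jl : ℕ → ℕ) [∀ K, DecidableEq (PBond (P K) (jl K))] [∀ K, DecidableEq (Plaq (P K) (jl K))]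
  {σ₀ : Type*} [DecidableEq σ₀]

/-- **ROW S19's LEVEL-0 FAMILY LEDGER IN THE SYNC TYPING: per-cutoff thresholds `θ₀ K`, under END-I's window, no `hD`.**
Hypotheses = file 1 §3's (`ShellMeasureWilsonLedgerWindow.levelLedger_wilson_su2_levelZero_family_window`: row S1's
geometry∕numerics per cutoff `K` on the lattice `P K`, bare coupling `β K ≥ 0`, chart window `S K`, co-test threshold
`σc K`, bounded source `|Fobs K| ≤ w`, the window `hwin`, the other run's measurable tested variables) with the
level-0 NUMERICS OF CUTOFF `K` READ AT ITS OWN THRESHOLD `θ₀ K`: `0 < θ₀ K ≤ σc K`, `4(8S_K)²e^{16S_K} ≤ δ·θ₀ K`, and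
the per-cube a.e. closeness `|wilsonU − u^B| ≤ ρ₀·θ₀ K` (node U1b TYPE at level 0).  CONCLUSION: END-I's one-run
`LevelLedger` in its literal `K`-indexed shape for the term families at `θ₀ K`, (M1)₀ discharged per `(K, s)` by row
S19 file 2's `slotAntiConcentration_wilson_su2_gibbs_source` at `θ := θ₀ K`, level constant file 1's window sum.
NOT NE7c; nothing printed asserted. [folklore] -/
theorem levelLedger_wilson_su2_levelZero_family_sync_window
    (lo hi : ∀ K, σ₀ → Fin (P K).d → ℤ) (m : ℕ → σ₀ → ℕ)
    (hN : ∀ K s κ, hi K s κ - lo K s κ < (P K).sitesPerDir (jl K)) (hm : ∀ K s κ, hi K s κ ≤ lo K s κ + m K s)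
    (Λ : ∀ K, σ₀ → Finset (PBond (P K) (jl K))) (hΛbox : ∀ K s, ∀ b ∈ Λ K s, b ∈ boxBonds (lo K s) (hi K s))
    (hΛcomb : ∀ K s, Disjoint (Λ K s) (combBonds (lo K s) (hi K s)))
    (hcov : ∀ K s, ∀ b ∈ boxBonds (lo K s) (hi K s), b ∉ Λ K s →
      b ∈ (combBonds (lo K s) (hi K s) : Finset (PBond (P K) (jl K))))
    (n : ℕ → σ₀ → ℕ) (e : ∀ K s, ↥(Λ K s) × Fin 3 ≃ Fin (n K s))
    (S σc : ℕ → ℝ) (hS : ∀ K, 0 < S K) (hS8 : ∀ K, S K ≤ 1 / 8) (hSπ : ∀ K, 3 * S K ^ 2 < Real.pi ^ 2)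
    (hσ : ∀ K, 0 < σc K) (hrad : ∀ K s, (((P K).d - 1 : ℕ) : ℝ) * m K s * σc K ≤ 2 * S K / Real.pi)
    (Pu : ∀ K, σ₀ → Finset (Plaq (P K) (jl K))) (hPu : ∀ K s, (Pu K s).Nonempty)
    (hPubox : ∀ K s, ∀ p ∈ Pu K s, p ∈ boxPlaqs (lo K s) (hi K s))
    (hboxPu : ∀ K s, boxPlaqs (lo K s) (hi K s) ⊆ (↑(Pu K s) : Set (Plaq (P K) (jl K))))
    (Pw Pext : ∀ K, σ₀ → Finset (Plaq (P K) (jl K))) (Pall : ∀ K, Finset (Plaq (P K) (jl K)))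
    (β : ℕ → ℝ) {δ : ℝ} {θ₀ ρ : ℕ → ℝ} (hβ : ∀ K, 0 ≤ β K) (hθ : ∀ K, 0 < θ₀ K) (hθσ : ∀ K, θ₀ K ≤ σc K)
    (hδ0 : 0 ≤ δ) (hδ1 : δ < 1) (hρ0 : ∀ i, 0 ≤ ρ i) (hρ : ρ 0 ≤ (1 - δ) / 2)
    (hSM : ∀ K, 4 * (8 * S K) ^ 2 * Real.exp (2 * (8 * S K)) ≤ δ * θ₀ K)
    (hSMσ : ∀ K, 4 * (8 * S K) ^ 2 * Real.exp (2 * (8 * S K)) ≤ δ * σc K)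
    (hPext : ∀ K s, ∀ p ∈ Pext K s, (⟨p.src, p.μ⟩ : PBond (P K) (jl K)) ∉ Λ K s ∧
      (⟨p.src.shift p.μ, p.ν⟩ : PBond (P K) (jl K)) ∉ Λ K s ∧ (⟨p.src.shift p.ν, p.μ⟩ : PBond (P K) (jl K)) ∉ Λ K s ∧
      (⟨p.src, p.ν⟩ : PBond (P K) (jl K)) ∉ Λ K s)
    (hdisj : ∀ K s, Disjoint (Pext K s) (Pw K s)) (hall : ∀ K s, Pext K s ∪ Pw K s = Pall K)
    (Fobs : ∀ K, GaugeField (P K) (jl K) SU2 → ℝ) {w l₀ : ℝ} (hw : 0 ≤ w) (hFw : ∀ K U, |Fobs K U| ≤ w)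
    (C : ℕ → Finset σ₀) {N₁ : ℕ} (hwin : ∀ K, ∀ s ∈ C K, K ≤ N₁)
    (uB : ∀ K : ℕ, ℝ → σ₀ → GaugeField (P K) (jl K) SU2 → ℝ)
    (huB : ∀ K t s, Measurable (uB K t s))
    (hclose : ∀ K t, |t| ≤ l₀ → ∀ s ∈ C K,
      ∀ᵐ U ∂((fieldMeasure (P K) (jl K) SU2).withDensity fun U => ENNReal.ofReal (Real.exp (t * Fobs K U)) *
        ENNReal.ofReal (Real.exp (-(β K * ∑ p ∈ Pall K, (1 - reTr (GaugeField.plaqHol U p)))))),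
        |wilsonU (hPu K s) U - uB K t s U| ≤ ρ 0 * θ₀ K) :
    LevelLedger l₀ (fun K => (C K).powerset)
      (fun K t => regionWeight (C K)
        ((fieldMeasure (P K) (jl K) SU2).withDensity fun U => ENNReal.ofReal (Real.exp (t * Fobs K U)) *
          ENNReal.ofReal (Real.exp (-(β K * ∑ p ∈ Pall K, (1 - reTr (GaugeField.plaqHol U p))))))
        (fun s => wilsonU (hPu K s)) (θ₀ K))
      (fun K t => regionShell (C K)
        ((fieldMeasure (P K) (jl K) SU2).withDensity fun U => ENNReal.ofReal (Real.exp (t * Fobs K U)) *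
          ENNReal.ofReal (Real.exp (-(β K * ∑ p ∈ Pall K, (1 - reTr (GaugeField.plaqHol U p))))))
        (fun s => wilsonU (hPu K s)) (uB K t) (θ₀ K))
      C
      (fun K t => regionPiece (C K)
        ((fieldMeasure (P K) (jl K) SU2).withDensity fun U => ENNReal.ofReal (Real.exp (t * Fobs K U)) *
          ENNReal.ofReal (Real.exp (-(β K * ∑ p ∈ Pall K, (1 - reTr (GaugeField.plaqHol U p))))))
        (fun s => wilsonU (hPu K s)) (uB K t) (θ₀ K))
      (fun _ _ => 0)
      (fun _ => ∑ K' ∈ Finset.range (N₁ + 1), ∑ s' ∈ C K',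
        2 * ((n K' s' : ℝ) + β K' * ∑ _p ∈ Pw K' s', (8 * S K') * (8 + 4 * (8 * S K'))) / (1 - δ) *
          Real.exp (2 * l₀ * w)) ρ := by
  -- every tilted Gibbs law is a finite measure (row S19 file 3's argument, verbatim)
  haveI : ∀ (K : ℕ) (t : ℝ), IsFiniteMeasure ((fieldMeasure (P K) (jl K) SU2).withDensity fun U =>
      ENNReal.ofReal (Real.exp (t * Fobs K U)) *
        ENNReal.ofReal (Real.exp (-(β K * ∑ p ∈ Pall K, (1 - reTr (GaugeField.plaqHol U p)))))) := fun K t => by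
    refine isFiniteMeasure_withDensity (ne_top_of_le_ne_top ?_ (lintegral_mono (g := fun _ =>
      ENNReal.ofReal (Real.exp (|t| * w))) fun U => ?_))
    · rw [lintegral_const]; exact ENNReal.mul_ne_top ENNReal.ofReal_ne_top (measure_ne_top _ _)
    · calc ENNReal.ofReal (Real.exp (t * Fobs K U)) *
            ENNReal.ofReal (Real.exp (-(β K * ∑ p ∈ Pall K, (1 - reTr (GaugeField.plaqHol U p)))))
          ≤ ENNReal.ofReal (Real.exp (|t| * w)) * 1 := by
            refine mul_le_mul' (ENNReal.ofReal_le_ofReal (Real.exp_le_exp.2 ?_)) ?_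
            · calc t * Fobs K U ≤ |t * Fobs K U| := le_abs_self _
                _ = |t| * |Fobs K U| := abs_mul _ _
                _ ≤ |t| * w := mul_le_mul_of_nonneg_left (hFw K U) (abs_nonneg t)
            · rw [ENNReal.ofReal_le_one, Real.exp_le_one_iff, neg_nonpos]
              exact mul_nonneg (hβ K) (wilsonSum_nonneg (Pall K) U)
        _ = ENNReal.ofReal (Real.exp (|t| * w)) := mul_one _
  have h1δ : 0 < 1 - δ := by linarith
  -- the per-(K, s) constants of row S19 file 2 are nonnegative
  have hDs : ∀ K, ∀ s ∈ C K, 0 ≤ 2 * ((n K s : ℝ) + β K * ∑ _p ∈ Pw K s, (8 * S K) * (8 + 4 * (8 * S K))) / (1 - δ) *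
      Real.exp (2 * l₀ * w) := fun K s _ => by
    have hSK := hS K
    exact mul_nonneg (div_nonneg (mul_nonneg zero_le_two (add_nonneg (Nat.cast_nonneg _)
      (mul_nonneg (hβ K) (Finset.sum_nonneg fun _ _ => by positivity)))) h1δ.le) (Real.exp_nonneg _)
  exact levelLedger_levelZero_cubes_sync_window
    (μ := fun K t => (fieldMeasure (P K) (jl K) SU2).withDensity fun U => ENNReal.ofReal (Real.exp (t * Fobs K U)) *
      ENNReal.ofReal (Real.exp (-(β K * ∑ p ∈ Pall K, (1 - reTr (GaugeField.plaqHol U p))))))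
    (uA := fun K _ s => wilsonU (hPu K s)) (θ₀ := θ₀)
    (Dslot := fun K s => 2 * ((n K s : ℝ) + β K * ∑ _p ∈ Pw K s, (8 * S K) * (8 + 4 * (8 * S K))) / (1 - δ) *
      Real.exp (2 * l₀ * w))
    (fun K _ s => measurable_wilsonU (hPu K s)) huB hclose hρ0 hDs hwin
    (fun K t ht s _ => slotAntiConcentration_wilson_su2_gibbs_source (hN K s) (hm K s) (Λ K s) (hΛbox K s)
      (hΛcomb K s) (hcov K s) (e K s) (hS K) (hS8 K) (hSπ K) (hσ K) (hrad K s) (hPu K s) (hPubox K s) (hboxPu K s)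
      (Pw K s) (Pext K s) (Pall K) (hβ K) (hθ K) (hθσ K) hδ0 hδ1 (hρ0 0) hρ (hSM K) (hSMσ K) (hPext K s) (hdisj K s)
      (hall K s) hw (hFw K) ht)

end Realized

/-! ## §3 Nothing landed is lost: the one-threshold faces are the constant case `θ₀ := fun _ => θ 0` -/

section Recover

variable {Ω : ℕ → Type*} [∀ K, MeasurableSpace (Ω K)] {σ : Type*} [DecidableEq σ] {C : ℕ → Finset σ} {l₀ : ℝ}

/-- row S17's `levelLedger_levelZero_cubes` (one threshold `θ 0` for every cutoff) IS §1's sync plug at the constant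
profile `θ₀ := fun _ => θ 0` — same binders, same conclusion. [folklore] -/
example {μ : ∀ K : ℕ, ℝ → Measure (Ω K)} [∀ K t, IsFiniteMeasure (μ K t)] {uA uB : ∀ K : ℕ, ℝ → σ → Ω K → ℝ}
    {θ ρ D : ℕ → ℝ} (huA : ∀ K t s, Measurable (uA K t s)) (huB : ∀ K t s, Measurable (uB K t s))
    (hclose : ∀ K t, |t| ≤ l₀ → ∀ s ∈ C K, ∀ᵐ ω ∂(μ K t), |uA K t s ω - uB K t s ω| ≤ ρ 0 * θ 0)
    (hD : ∀ j, 0 ≤ D j) (hρ : ∀ j, 0 ≤ ρ j)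
    (hac : ∀ K t, |t| ≤ l₀ → ∀ s ∈ C K, SlotAntiConcentration (μ K t) (uA K t s) (θ 0) (ρ 0) (D 0)) :
    LevelLedger l₀ (fun K => (C K).powerset) (fun K t => regionWeight (C K) (μ K t) (uA K t) (θ 0))
      (fun K t => regionShell (C K) (μ K t) (uA K t) (uB K t) (θ 0)) C
      (fun K t => regionPiece (C K) (μ K t) (uA K t) (uB K t) (θ 0)) (fun _ _ => 0) D ρ :=
  levelLedger_levelZero_cubes_sync (θ₀ := fun _ => θ 0) huA huB hclose hD hρ hac

/-- … and conversely §1's sync plug at a constant profile is row S17's theorem itself (both produce the same `Prop`;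
stated for the record). [folklore] -/
example {μ : ∀ K : ℕ, ℝ → Measure (Ω K)} [∀ K t, IsFiniteMeasure (μ K t)] {uA uB : ∀ K : ℕ, ℝ → σ → Ω K → ℝ}
    {θ ρ D : ℕ → ℝ} (huA : ∀ K t s, Measurable (uA K t s)) (huB : ∀ K t s, Measurable (uB K t s))
    (hclose : ∀ K t, |t| ≤ l₀ → ∀ s ∈ C K, ∀ᵐ ω ∂(μ K t), |uA K t s ω - uB K t s ω| ≤ ρ 0 * θ 0)
    (hD : ∀ j, 0 ≤ D j) (hρ : ∀ j, 0 ≤ ρ j)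
    (hac : ∀ K t, |t| ≤ l₀ → ∀ s ∈ C K, SlotAntiConcentration (μ K t) (uA K t s) (θ 0) (ρ 0) (D 0)) :
    LevelLedger l₀ (fun K => (C K).powerset) (fun K t => regionWeight (C K) (μ K t) (uA K t) (θ 0))
      (fun K t => regionShell (C K) (μ K t) (uA K t) (uB K t) (θ 0)) C
      (fun K t => regionPiece (C K) (μ K t) (uA K t) (uB K t) (θ 0)) (fun _ _ => 0) D ρ :=
  levelLedger_levelZero_cubes huA huB hclose hD hρ hac

end Recover

end Summit.QuantumFields.BalabanUV.T4Continuum.ShellMeasureWilsonLedgerSync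

end
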